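import Literature.MathematicalPhysics.QuantumFieldTheory.Balaban1983to89.B9Eq384LaplaceALipschitz
import Literature.MathematicalPhysics.QuantumFieldTheory.Balaban1983to89.B9Eq368RLipschitzTwoBackgrounds
import Literature.MathematicalPhysics.QuantumFieldTheory.Balaban1983to89.B9Eq379QLipschitzGeneral
import Literature.MathematicalPhysics.QuantumFieldTheory.Balaban1983to89.B9Ineq369CurvatureTwoBackgrounds

/-!
# `Balaban1983to89.B9Eq384LaplaceALipschitzTwoBackgrounds` — T. Bałaban, *Propagators for lattice gauge theories in a background field*, Commun.
# Math. Phys. **99** (1985) 389–434 [Balaban1985BackgroundPropagators] (3.82)–(3.84) p. 407 with (3.70)–(3.79) pp. 404–406: AT A FIXED LATTICE THE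
# pub-balaban NE9 CHAIN'S PRINCIPAL GAUGE-FIXED OPERATOR `P(U) = D*D + DR(U)D* + aQ(U)*Q(U)` IS LIPSCHITZ IN THE BACKGROUND ON THE SMALL-BOND BALL —
# `‖P(U)x − P(U′)x‖ ≤ K·‖U − U′‖_∞·‖x‖` for `‖U(b) − 1‖, ‖U′(b) − 1‖ ≤ ε ≤ ε₀`, with NO displayed averaging letter: print's
# «Δ_a(U′U) = Δ_a(U) − V(A), V = V₃ + P₁ + P₂» at a GENERAL `U`, every remainder produced — `V₃` by (B)₂, `P₁` by (Q3a)₂, `P₂ = F₂` by (δ_Q)₂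

statement-level skeleton of published theorems with citation tags; proofs where landed; nothing here is a claim about the Yang–Mills mass gap

PDF held: `paper:balaban1985-cmp99-background-propagators` (journal page = PDF page + 388); pp. 404–407 through the verbatim quotations of
`B9Eq384LaplaceALipschitz` ∕ `B9Thm311SmallFieldCoercivity` (NE9 owner gens 80–81), whose assembly `B9Eq384RemainderLetters.norm_laplaceAK_sub_le`
this file instantiates a second time, between two backgrounds.

CITATION HEADER (lean-in-tree rule 2026-08-18).  Audit cell `pub-balaban`, sub-cell `t4`, NE9 crux team (2): LEAF PROVER 04
(`b2b-balaban-t4-ne9-formalise-leaf-04` gen 73) — the TWO-BACKGROUND twin of the NE9 owner's (Q1) `B9Eq384LaplaceALipschitz.exists_principalGF_sub_flat_linear`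
(flat base point, averaging letters `ρ′`, `δ_Q` displayed), the second junction above the three two-background letters of the owner's census item (i)
(journal `CLAIMS.log` l.42142) supplied by this lineage: (δ_Q)₂ `B9Eq379QLipschitzGeneral`, (B)₂ `B9Eq373DerivativeRemainderTwoBackgrounds`, (ρ′)₂
`B9Eq319QprimeLipschitzTwoBackgrounds`, (Q3a)₂ `B9Eq368RLipschitzTwoBackgrounds`.

THE PRINT (as quoted in `B9Thm311SmallFieldCoercivity`).  p. 407, (3.82): *«Δ_a(U′U) = … = Δ_a(U) − V₃(A) − P₁(A) − P₂(A). The operator V₃(A) is a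
local differential operator of the first order satisfying the bound (3.73).»*; (3.84): *«Δ_a(U′U) = Δ_a(U) − V(A) = (I − V(A)G(U))Δ_a(U)»*; p. 406, (3.79):
*«|F₂(B)B′| ≤ O(1) sup|B| sup|B′| … The constant O(1) above depends only on d and L.»*  `U` is a GENERAL background of the regularity class,
`U′ = e^{iηA}` its perturbation.

WHY THIS FILE (cell context).  The chain's chart of the curve species is Lipschitz in the background AT THE FLAT POINT (`Support/NE9CurChartLipschitzAtFlat`,
owner gen 82) through the flat-point letters (Q1)(Q2)(Q3a)(Q3); the same chart between TWO GENERAL small-bond backgrounds — the owner's census item (i)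
«two general small fields» — starts from the principal operator compared at `U` and `U′`.  Here that comparison is a THEOREM with the averaging
letters DISCHARGED: `ρ′(U,U′)` by (ρ′)₂ inside (Q3a)₂, `δ_Q(U,U′)` by (δ_Q)₂ §6 (Prop. 7 of [Balaban1985Averaging] by the Cauchy route), the bound of
`Q(U′)` by the flat-point `δ_Q` of this lineage's `B9Eq315QLipschitz`.

WHAT IS PROVED (sorry-free; no `Prop` placeholder; no inequality of the paper asserted).
* §1 **`exists_principalGF_sub_principalGF_linear`** — `∃ K ε₀ > 0` (finite-lattice numbers) such that for every pair `U`, `U′` of backgrounds on the torus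
  with their `QtorusW` regularity letters, `U(b), U′(b) ∈ U1`, `‖U(b) − 1‖, ‖U′(b) − 1‖ ≤ ε ≤ ε₀`, `‖U(b) − U′(b)‖ ≤ δ` and mutually adjoint fibre
  transporters (`hRS`, `hRS′`): `‖P(U)x − P(U′)x‖ ≤ K·δ·‖x‖` for `P(V) = D*_V D_V + D_V R(V) D*_V + aQ(V)*Q(V)` (`laplaceALatticeK … (principalOpK φ η V)
  (RofU … V) (QtorusW … V …) a`) — `B9Eq384RemainderLetters.norm_laplaceAK_sub_le` with `δP = 32d(1+K_Rε)|η|⁻²·K_Rδ₀` ((B)₂ `norm_principal_sub_le₂`),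
  `δD = |η|⁻¹K_Rδ₀√d` ((B)₂), `MD = 2(1+K_Rε)|η|⁻¹√d`, `δR = C_R·δ` ((Q3a)₂), `δQ = C_Q·δ₀` ((δ_Q)₂ §6), `MQ = ‖Q(1)‖ + C_Q^♭·ε` (this lineage's flat
  `δ_Q`), `δ₀ = δ ∧ 2ε`, `K_R = 2M_φM_φ′`; the real bookkeeping in the private `assemble_budget`.
* §2 **`exists_laplaceAofBackground_sub_laplaceAofBackground_le`** — the same for the chain's ASSEMBLED `Δ_a(U) = laplaceAofBackground … U … τ η a`
  ((3.26) with `Q := Q(U)`; `= P(U)-assembly + Δ′(U)` by `hessOp_apply`): `∃ C_Δ ε₆ > 0`, `‖Δ_a(U)x − Δ_a(U′)x‖ ≤ C_Δ·δ·‖x‖` — §1 plus the curvature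
  part compared by `B9Ineq369CurvatureTwoBackgrounds.norm_curvOp_sub_le` (plaquette holonomies of `U` within `4ε ≤ 1` of `1` by
  `B9Thm311SmallFieldClosed.norm_plaqHolU_sub_one_le`).  The two-background twin of (Q1) §2 `exists_laplaceAofBackground_sub_flat_le`.
MODEL / HONEST SCOPE.  [folklore] finite-dimensional perturbation bookkeeping at a FIXED lattice (`K, ε₀` depend on `L, m, η, c₀, c₁, a, M_φ, M_φ′` — the
centre lift `∼ √|T|`, `‖Q(1)‖`, the Cauchy constants `75497472(d+1)N`); both backgrounds in the small-bond ball (`ε₀ ≤ 1∕(24576N)`, `≤ 1∕(256(d+1)L)`, the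
(Q3a)₂ threshold); §1 without, §2 with the curvature part `Δ′(U)` (as (Q1) §1 ∕ §2); NOT print's analytic `V(A)`, NOT
uniformity in the lattice; a junction of a two-general-backgrounds chart, NOT that chart, NOT [B9] Thm 3.11, NOT NE9; NOT summit progress (cell pub-balaban:
NE9 NOT PRINTED ∕ NOT PROVED; spine PROVED 0∕9; rung (B)+1 finite T⁴ — NOT infinite volume, NOT mass gap, NOT Clay).  NEW file importing
`B9Eq384LaplaceALipschitz`, `B9Eq368RLipschitzTwoBackgrounds`, `B9Eq379QLipschitzGeneral`, `B9Ineq369CurvatureTwoBackgrounds`; nothing of the NE9-owner ∕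
leaf-03 lineages' files is modified.  Net new unproved facts: 0.
-/

noncomputable section

open scoped InnerProductSpace ComplexConjugate BigOperators

namespace Literature.MathematicalPhysics.QuantumFieldTheory.Balaban1983to89.B9Eq384LaplaceALipschitzTwoBackgrounds

open B4Sect5Torus (TSite)
open B9SectCLatticeCarrier (Bond)
open B7Prop1Explicit (U1 Wcx boxVec)
open B9Eq311L2Pairing (WL2)
open B9Eq319QprimeTorus (fineP)
open B11Eq103H1Complex (SiteL2K BondL2K covDerivL2K covDivL2K laplaceALatticeK RLatticeK)
open B9Eq310HessianOperator (adTransportW principalOpK covCurlL2K covCoCurlL2K)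
open B9Eq326OperatorAssembly (RofU)
open B9Eq315QTorus (perCfg cornerSite QtorusW)
open B5Eq172FlatCoercivity (hU1_one hreg_one)
open B9Eq368ProjectionRemainder (norm_projR_le)
open B9Eq373DerivativeRemainderL2 (norm_covDerivL2K_le norm_covDivL2K_le)
open B9Eq373DerivativeRemainderTwoBackgrounds (norm_covDerivL2K_sub_le₂ norm_covDivL2K_sub_le₂ norm_principal_sub_le₂)
open B9Eq384RemainderLetters (norm_laplaceAK_sub_le norm_adTransportW_sub_le)
open B9Eq368RLipschitzTwoBackgrounds (exists_RofU_sub_RofU_linear norm_adTransportW_sub_adTransportW_le)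
open B9Eq315QLipschitz (norm_QtorusW_sub_flat_le)
open B9Eq379QLipschitzGeneral (norm_QtorusW_sub_QtorusW_le_of_bonds)
open B9Eq315QTorus (laplaceAofBackground)
open B9Eq315QTorusOnto (liftSite perSite_liftSite)
open B9Eq310HessianOperator (hessOp hessOp_apply curvOp)
open B9Eq310DeltaPrime (plaqHolU)
open B9Thm311SmallFieldClosed (norm_plaqHolU_sub_one_le)
open B9Ineq369CurvatureTwoBackgrounds (norm_curvOp_sub_le)

/-- THE ASSEMBLY BUDGET (pure real arithmetic, kept out of the main proof's context): the four pieces of `norm_laplaceAK_sub_le` against `K·δ` under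
`K_Rε ≤ 1`, `ε ≤ 1`, `δ₀ ≤ δ`, `δ₀ ≤ 2ε`. [folklore] -/
private theorem assemble_budget {d p sd KR CR CQ CQf MQ a ε δ δ₀ : ℝ} (hd : 0 ≤ d) (hsd : sd * sd = d)
    (hKR : 0 ≤ KR) (hCR : 0 ≤ CR) (hCQ : 0 ≤ CQ) (hCQf : 0 ≤ CQf) (hMQ : 0 ≤ MQ) (hε : 0 ≤ ε) (hε1 : ε ≤ 1) (hKε : KR * ε ≤ 1)
    (hδ : 0 ≤ δ) (hδ₀ : 0 ≤ δ₀) (hδ₀δ : δ₀ ≤ δ) (hδ₀ε : δ₀ ≤ 2 * ε) :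
    32 * d * (1 + KR * ε) * p ^ 2 * (KR * δ₀) + 2 * (2 * (1 + KR * ε) * p * sd) * (p * (KR * δ₀) * sd)
        + (2 * (1 + KR * ε) * p * sd) ^ 2 * (CR * δ) + |a| * (CQ * δ₀) * (2 * (MQ + CQf * ε) + CQ * δ₀) ≤
      (64 * d * p ^ 2 * KR + 8 * p ^ 2 * d * KR + 16 * p ^ 2 * d * CR + |a| * CQ * (2 * (MQ + CQf) + 2 * CQ) + 1) * δ := by
  have h1e : 1 + KR * ε ≤ 2 := by linarith
  have h1e0 : 0 ≤ 1 + KR * ε := by positivity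
  have hKδ : KR * δ₀ ≤ KR * δ := mul_le_mul_of_nonneg_left hδ₀δ hKR
  have hA : 32 * d * (1 + KR * ε) * p ^ 2 * (KR * δ₀) ≤ 64 * d * p ^ 2 * KR * δ := by
    calc 32 * d * (1 + KR * ε) * p ^ 2 * (KR * δ₀) = (32 * d * p ^ 2) * ((1 + KR * ε) * (KR * δ₀)) := by ring
      _ ≤ (32 * d * p ^ 2) * (2 * (KR * δ)) :=
          mul_le_mul_of_nonneg_left (mul_le_mul h1e hKδ (by positivity) (by norm_num)) (by positivity)
      _ = 64 * d * p ^ 2 * KR * δ := by ring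
  have hB : 2 * (2 * (1 + KR * ε) * p * sd) * (p * (KR * δ₀) * sd) ≤ 8 * p ^ 2 * d * KR * δ := by
    calc 2 * (2 * (1 + KR * ε) * p * sd) * (p * (KR * δ₀) * sd) = (4 * p ^ 2 * (sd * sd)) * ((1 + KR * ε) * (KR * δ₀)) := by ring
      _ ≤ (4 * p ^ 2 * (sd * sd)) * (2 * (KR * δ)) :=
          mul_le_mul_of_nonneg_left (mul_le_mul h1e hKδ (by positivity) (by norm_num)) (by rw [hsd]; positivity)
      _ = 8 * p ^ 2 * d * KR * δ := by rw [hsd]; ring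
  have hC : (2 * (1 + KR * ε) * p * sd) ^ 2 * (CR * δ) ≤ 16 * p ^ 2 * d * CR * δ := by
    have hsq : (1 + KR * ε) ^ 2 ≤ 4 := by
      calc (1 + KR * ε) ^ 2 ≤ 2 ^ 2 := pow_le_pow_left₀ h1e0 h1e 2
        _ = 4 := by norm_num
    calc (2 * (1 + KR * ε) * p * sd) ^ 2 * (CR * δ) = (1 + KR * ε) ^ 2 * (4 * p ^ 2 * (sd * sd) * (CR * δ)) := by ring
      _ ≤ 4 * (4 * p ^ 2 * (sd * sd) * (CR * δ)) := mul_le_mul_of_nonneg_right hsq (by rw [hsd]; positivity)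
      _ = 16 * p ^ 2 * d * CR * δ := by rw [hsd]; ring
  have hD : |a| * (CQ * δ₀) * (2 * (MQ + CQf * ε) + CQ * δ₀) ≤ |a| * CQ * (2 * (MQ + CQf) + 2 * CQ) * δ := by
    have h2 : 2 * (MQ + CQf * ε) + CQ * δ₀ ≤ 2 * (MQ + CQf) + 2 * CQ := by nlinarith
    have h20 : 0 ≤ 2 * (MQ + CQf * ε) + CQ * δ₀ := by positivity
    calc |a| * (CQ * δ₀) * (2 * (MQ + CQf * ε) + CQ * δ₀) = (|a| * CQ) * (δ₀ * (2 * (MQ + CQf * ε) + CQ * δ₀)) := by ring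
      _ ≤ (|a| * CQ) * (δ * (2 * (MQ + CQf) + 2 * CQ)) :=
          mul_le_mul_of_nonneg_left (mul_le_mul hδ₀δ h2 h20 hδ) (by positivity)
      _ = |a| * CQ * (2 * (MQ + CQf) + 2 * CQ) * δ := by ring
  have h1δ : 0 ≤ 1 * δ := by positivity
  nlinarith [hA, hB, hC, hD, h1δ]

variable {d : ℕ} (L : ℕ) [NeZero L] (m : Fin d → ℕ) [∀ i, NeZero (fineP L m i)] (hL : 1 ≤ L)
  {𝔸 : Type*} [NormedRing 𝔸] [NormedAlgebra ℂ 𝔸] [CompleteSpace 𝔸] [NormOneClass 𝔸]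
  {W : Type*} [NormedAddCommGroup W] [InnerProductSpace ℂ W] [FiniteDimensional ℂ W] (φ : W ≃ₗ[ℂ] 𝔸) {c₀ c₁ : ℝ} [Fact (0 < c₀)] [Fact (0 < c₁)]

/-- **THE PRINCIPAL GAUGE-FIXED OPERATOR IS LIPSCHITZ IN THE BACKGROUND ON THE SMALL-BOND BALL** — (3.82)∕(3.84) «Δ_a(U′U) = Δ_a(U) − V(A)» with
`‖V‖ = O(‖U′U − U‖)` AT A GENERAL `U`, for the chain's `P(V) = D*D + DR(V)D* + aQ(V)*Q(V)`: `∃ K ε₀ > 0` (finite-lattice numbers) such that for every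
pair `U`, `U′` with `U(b), U′(b) ∈ U1`, `‖U(b) − 1‖, ‖U′(b) − 1‖ ≤ ε ≤ ε₀`, `‖U(b) − U′(b)‖ ≤ δ`, `hRS`, `hRS′`: `‖P(U)x − P(U′)x‖ ≤ K·δ·‖x‖` — the
assembly `norm_laplaceAK_sub_le` on the two-background letters of (B)₂ (`D`, `D*`, `D*D`), (Q3a)₂ (`R`), (δ_Q)₂ §6 (`Q`) and the flat `δ_Q`
(bound of `Q(U′)`); NO averaging letter displayed. [cite: Balaban1985BackgroundPropagators, (3.82)–(3.84) p.407, (3.70)–(3.79) pp.404–406] -/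
theorem exists_principalGF_sub_principalGF_linear {η : ℝ} (hη : η ≠ 0) (a : ℝ) {Mφ Mφ' : ℝ} (hMφ : 0 ≤ Mφ) (hMφ' : 0 ≤ Mφ')
    (hφ : ∀ w, ‖φ w‖ ≤ Mφ * ‖w‖) (hφ' : ∀ X, ‖φ.symm X‖ ≤ Mφ' * ‖X‖) :
    ∃ K ε₀ : ℝ, 0 < K ∧ 0 < ε₀ ∧ ∀ (U U' : Bond d (fineP L m) → 𝔸ˣ) {α α' : ℝ} (hα1 : α ≤ 1 / 64)
      (hU1 : ∀ (x : B7Prop1Explicit.Site d) (κ : Fin d), perCfg (fineP L m) U x κ ∈ U1 𝔸)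
      (hreg : ∀ (y : TSite d m) (κ : Fin d) (r : Fin d → Fin L), ‖((Wcx L (perCfg (fineP L m) U) (cornerSite L y) κ (boxVec L r) : 𝔸ˣ) : 𝔸) - 1‖ ≤ α)
      (hα1' : α' ≤ 1 / 64)
      (hU1' : ∀ (x : B7Prop1Explicit.Site d) (κ : Fin d), perCfg (fineP L m) U' x κ ∈ U1 𝔸)
      (hreg' : ∀ (y : TSite d m) (κ : Fin d) (r : Fin d → Fin L), ‖((Wcx L (perCfg (fineP L m) U') (cornerSite L y) κ (boxVec L r) : 𝔸ˣ) : 𝔸) - 1‖ ≤ α')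
      {ε δ : ℝ}, 0 ≤ ε → ε ≤ ε₀ → 0 ≤ δ →
      (∀ b, U b ∈ U1 𝔸) → (∀ b, U' b ∈ U1 𝔸) → (∀ b, ‖(U b : 𝔸) - 1‖ ≤ ε) → (∀ b, ‖(U' b : 𝔸) - 1‖ ≤ ε) →
      (∀ b, ‖(U b : 𝔸) - (U' b : 𝔸)‖ ≤ δ) →
      (∀ (b : Bond d (fineP L m)) (v u : W), ⟪adTransportW φ U b v, u⟫_ℂ = ⟪v, adTransportW φ (fun b => (U b)⁻¹) b u⟫_ℂ) →
      (∀ (b : Bond d (fineP L m)) (v u : W), ⟪adTransportW φ U' b v, u⟫_ℂ = ⟪v, adTransportW φ (fun b => (U' b)⁻¹) b u⟫_ℂ) →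
      ∀ x : BondL2K ℂ d (fineP L m) c₀ W,
        ‖laplaceALatticeK ((η : ℂ))⁻¹ (adTransportW φ U) (adTransportW φ fun b => (U b)⁻¹) (principalOpK φ η U) (RofU L m φ η U)
            (QtorusW L m hL φ U hα1 hU1 hreg (c₁ := c₁)) a x -
          laplaceALatticeK ((η : ℂ))⁻¹ (adTransportW φ U') (adTransportW φ fun b => (U' b)⁻¹) (principalOpK φ η U') (RofU L m φ η U')
            (QtorusW L m hL φ U' hα1' hU1' hreg' (c₁ := c₁)) a x‖ ≤
        K * δ * ‖x‖ := by
  have hc₀ : 0 < c₀ := Fact.out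
  have hc : conj ((η : ℂ))⁻¹ = ((η : ℂ))⁻¹ := by rw [map_inv₀, Complex.conj_ofReal]
  have hL0 : (0 : ℝ) < L := by exact_mod_cast hL
  -- the `R`-letter between two backgrounds ((Q3a)₂)
  obtain ⟨CR, εR₀, hCR, hεR₀, hRlip⟩ := exists_RofU_sub_RofU_linear L m φ (c₀ := c₀) hη hMφ hMφ' hφ hφ'
  -- constants
  have hp : (0 : ℝ) ≤ ‖((η : ℂ))⁻¹‖ := norm_nonneg _
  have hdn : (0 : ℝ) ≤ (d : ℝ) := Nat.cast_nonneg d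
  have hsd : Real.sqrt d * Real.sqrt d = d := Real.mul_self_sqrt hdn
  obtain ⟨KR, hKRdef⟩ : ∃ KR : ℝ, KR = 2 * Mφ * Mφ' := ⟨_, rfl⟩
  have hKR : 0 ≤ KR := by rw [hKRdef]; positivity
  obtain ⟨N, hNdef⟩ : ∃ N : ℝ, N = ((2 * (d * L) + L + L : ℕ) : ℝ) := ⟨_, rfl⟩
  have hN1 : (1 : ℝ) ≤ N := by
    have : 1 ≤ 2 * (d * L) + L + L := by omega
    rw [hNdef]; exact_mod_cast this
  have hN : 0 < N := by linarith
  obtain ⟨MQ, hMQdef⟩ : ∃ MQ : ℝ, MQ = ‖LinearMap.toContinuousLinearMap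
    (QtorusW L m hL φ (fun _ => 1) (show (0 : ℝ) ≤ 1 / 64 by norm_num) (hU1_one L m) (hreg_one L m) (c₀ := c₀) (c₁ := c₁))‖ := ⟨_, rfl⟩
  have hMQ : 0 ≤ MQ := by rw [hMQdef]; positivity
  have hQflat : ∀ y : BondL2K ℂ d (fineP L m) c₀ W,
      ‖QtorusW L m hL φ (fun _ => 1) (show (0 : ℝ) ≤ 1 / 64 by norm_num) (hU1_one L m) (hreg_one L m) (c₀ := c₀) (c₁ := c₁) y‖ ≤ MQ * ‖y‖ :=
    fun y => by
      rw [hMQdef]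
      exact (LinearMap.toContinuousLinearMap
        (QtorusW L m hL φ (fun _ => 1) (show (0 : ℝ) ≤ 1 / 64 by norm_num) (hU1_one L m) (hreg_one L m) (c₀ := c₀) (c₁ := c₁))).le_opNorm y
  obtain ⟨CQf, hCQfdef⟩ : ∃ CQf : ℝ, CQf = Mφ' * Mφ * Real.sqrt (c₁ * Fintype.card (Bond d m) / c₀) * (102 * ((d : ℝ) + 1) ^ 2 * L) := ⟨_, rfl⟩
  have hCQf : 0 ≤ CQf := by rw [hCQfdef]; positivity
  obtain ⟨CQ, hCQdef⟩ : ∃ CQ : ℝ, CQ = Mφ' * Mφ * Real.sqrt (c₁ * Fintype.card (Bond d m) / c₀) * (75497472 * ((d : ℝ) + 1) * N) := ⟨_, rfl⟩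
  have hCQ : 0 ≤ CQ := by rw [hCQdef]; positivity
  obtain ⟨K, hKdef⟩ : ∃ K : ℝ, K = 64 * d * ‖((η : ℂ))⁻¹‖ ^ 2 * KR + 8 * ‖((η : ℂ))⁻¹‖ ^ 2 * d * KR + 16 * ‖((η : ℂ))⁻¹‖ ^ 2 * d * CR +
    |a| * CQ * (2 * (MQ + CQf) + 2 * CQ) + 1 := ⟨_, rfl⟩
  have hK : 0 < K := by rw [hKdef]; positivity
  refine ⟨K, min εR₀ (min (1 / (KR + 1)) (min 1 (min (1 / (256 * ((d : ℝ) + 1) * L)) (1 / (24576 * N))))), hK, by positivity, ?_⟩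
  intro U U' α α' hα1 hU1 hreg hα1' hU1' hreg' ε δ hε hε₀ hδ hUb hU'b hUε hU'ε hUU' hRS hRS' x
  -- smallness consequences
  have hεR : ε ≤ εR₀ := hε₀.trans (min_le_left _ _)
  have hεK : ε ≤ 1 / (KR + 1) := hε₀.trans ((min_le_right _ _).trans (min_le_left _ _))
  have hε1 : ε ≤ 1 := hε₀.trans ((min_le_right _ _).trans ((min_le_right _ _).trans (min_le_left _ _)))
  have hεreg' : ε ≤ 1 / (256 * ((d : ℝ) + 1) * L) :=
    hε₀.trans ((min_le_right _ _).trans ((min_le_right _ _).trans ((min_le_right _ _).trans (min_le_left _ _))))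
  have hεN' : ε ≤ 1 / (24576 * N) :=
    hε₀.trans ((min_le_right _ _).trans ((min_le_right _ _).trans ((min_le_right _ _).trans (min_le_right _ _))))
  have hKε1 : KR * ε ≤ 1 := by
    refine (mul_le_mul_of_nonneg_left hεK hKR).trans ?_
    rw [mul_one_div, div_le_one (by positivity)]; linarith
  have hεreg : 2 * ((d : ℝ) + 1) * L * ε ≤ 1 / 128 := by
    have := mul_le_mul_of_nonneg_left hεreg' (by positivity : (0 : ℝ) ≤ 2 * ((d : ℝ) + 1) * L)
    refine this.trans (le_of_eq ?_)
    field_simp; ring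
  -- the effective distance `δ₀ = δ ∧ 2ε`
  obtain ⟨δ₀, hδ₀def⟩ : ∃ δ₀ : ℝ, δ₀ = min δ (2 * ε) := ⟨_, rfl⟩
  have hδ₀ : 0 ≤ δ₀ := by rw [hδ₀def]; exact le_min hδ (by positivity)
  have hδ₀δ : δ₀ ≤ δ := by rw [hδ₀def]; exact min_le_left _ _
  have hδ₀ε : δ₀ ≤ 2 * ε := by rw [hδ₀def]; exact min_le_right _ _
  have hδ₀N : δ₀ ≤ 1 / (12288 * ((2 * (d * L) + L + L : ℕ) : ℝ)) := by
    rw [← hNdef]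
    refine hδ₀ε.trans ?_
    have := mul_le_mul_of_nonneg_left hεN' (by norm_num : (0 : ℝ) ≤ 2)
    refine this.trans (le_of_eq ?_)
    field_simp; norm_num
  have hUU'₀ : ∀ b, ‖(U b : 𝔸) - (U' b : 𝔸)‖ ≤ δ₀ := fun b => by
    rw [hδ₀def]
    refine le_min (hUU' b) ?_
    calc ‖(U b : 𝔸) - (U' b : 𝔸)‖ = ‖((U b : 𝔸) - 1) - ((U' b : 𝔸) - 1)‖ := by rw [sub_sub_sub_cancel_right]
      _ ≤ ‖(U b : 𝔸) - 1‖ + ‖(U' b : 𝔸) - 1‖ := norm_sub_le _ _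
      _ ≤ 2 * ε := by linarith [hUε b, hU'ε b]
  -- the fibre transporters: `K_Rε`-close to the identity, `K_Rδ₀`-close to each other
  have hεR0 : 0 ≤ KR * ε := mul_nonneg hKR hε
  have hδR0 : 0 ≤ KR * δ₀ := mul_nonneg hKR hδ₀
  have hR : ∀ (b : Bond d (fineP L m)) (w : W), ‖adTransportW φ U b w - w‖ ≤ KR * ε * ‖w‖ := fun b w => by
    have h := norm_adTransportW_sub_le φ hφ hφ' hMφ' U b (hUb b) (hUε b) w
    rw [hKRdef]; linarith
  have hR' : ∀ (b : Bond d (fineP L m)) (w : W), ‖adTransportW φ U' b w - w‖ ≤ KR * ε * ‖w‖ := fun b w => by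
    have h := norm_adTransportW_sub_le φ hφ hφ' hMφ' U' b (hU'b b) (hU'ε b) w
    rw [hKRdef]; linarith
  have hRR' : ∀ (b : Bond d (fineP L m)) (w : W), ‖adTransportW φ U b w - adTransportW φ U' b w‖ ≤ KR * δ₀ * ‖w‖ := fun b w => by
    have h := norm_adTransportW_sub_adTransportW_le L m φ hφ hφ' hMφ' U U' b (hUb b) (hU'b b) (hUU'₀ b) w
    rw [hKRdef]; linarith
  -- the letters of `norm_laplaceAK_sub_le`
  have hP : ∀ y : BondL2K ℂ d (fineP L m) c₀ W, ‖principalOpK φ η U y - principalOpK φ η U' y‖ ≤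
      32 * d * (1 + KR * ε) * ‖((η : ℂ))⁻¹‖ ^ 2 * (KR * δ₀) * ‖y‖ := fun y => by
    rw [B9Eq310HessianOperator.principalOpK_eq_comp, B9Eq310HessianOperator.principalOpK_eq_comp, LinearMap.comp_apply,
      LinearMap.comp_apply]
    exact norm_principal_sub_le₂ _ hc hεR0 hδR0 hR hR' hRR' hRS hRS' y
  have hD : ∀ f : SiteL2K ℂ d (fineP L m) c₀ W,
      ‖covDerivL2K ℂ c₀ ((η : ℂ))⁻¹ (adTransportW φ U) f - covDerivL2K ℂ c₀ ((η : ℂ))⁻¹ (adTransportW φ U') f‖ ≤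
        ‖((η : ℂ))⁻¹‖ * (KR * δ₀) * Real.sqrt d * ‖f‖ := norm_covDerivL2K_sub_le₂ _ hδR0 hRR'
  have hDs : ∀ y : BondL2K ℂ d (fineP L m) c₀ W,
      ‖covDivL2K ℂ c₀ ((η : ℂ))⁻¹ (adTransportW φ fun b => (U b)⁻¹) y - covDivL2K ℂ c₀ ((η : ℂ))⁻¹ (adTransportW φ fun b => (U' b)⁻¹) y‖ ≤
        ‖((η : ℂ))⁻¹‖ * (KR * δ₀) * Real.sqrt d * ‖y‖ := norm_covDivL2K_sub_le₂ _ hc hδR0 hRR' hRS hRS'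
  have hD₁ : ∀ f : SiteL2K ℂ d (fineP L m) c₀ W,
      ‖covDerivL2K ℂ c₀ ((η : ℂ))⁻¹ (adTransportW φ U') f‖ ≤ 2 * (1 + KR * ε) * ‖((η : ℂ))⁻¹‖ * Real.sqrt d * ‖f‖ :=
    norm_covDerivL2K_le _ hεR0 hR'
  have hDs₂ : ∀ y : BondL2K ℂ d (fineP L m) c₀ W,
      ‖covDivL2K ℂ c₀ ((η : ℂ))⁻¹ (adTransportW φ fun b => (U b)⁻¹) y‖ ≤ 2 * (1 + KR * ε) * ‖((η : ℂ))⁻¹‖ * Real.sqrt d * ‖y‖ :=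
    norm_covDivL2K_le _ hc hεR0 hR hRS
  have hRn₁ : ∀ z : SiteL2K ℂ d (fineP L m) c₀ W, ‖RofU L m φ η U' z‖ ≤ ‖z‖ := fun z => by
    unfold RofU RLatticeK; exact norm_projR_le _ _ z
  have hRn₂ : ∀ z : SiteL2K ℂ d (fineP L m) c₀ W, ‖RofU L m φ η U z‖ ≤ ‖z‖ := fun z => by
    unfold RofU RLatticeK; exact norm_projR_le _ _ z
  have hRd : ∀ z : SiteL2K ℂ d (fineP L m) c₀ W, ‖RofU L m φ η U z - RofU L m φ η U' z‖ ≤ CR * δ * ‖z‖ :=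
    hRlip U U' hε hεR hδ hUb hU'b hUε hU'ε hUU' hRS hRS'
  have hQ : ∀ y : BondL2K ℂ d (fineP L m) c₀ W,
      ‖QtorusW L m hL φ U hα1 hU1 hreg (c₁ := c₁) y - QtorusW L m hL φ U' hα1' hU1' hreg' (c₁ := c₁) y‖ ≤ CQ * δ₀ * ‖y‖ := fun y => by
    refine (norm_QtorusW_sub_QtorusW_le_of_bonds L m hL U hα1 hU1 hreg U' hα1' hU1' hreg' hε hU'ε hεreg hδ₀ hδ₀N hUU'₀ φ
      (c₀ := c₀) (c₁ := c₁) hMφ hφ hMφ' hφ' y).trans (le_of_eq ?_)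
    rw [hCQdef, hNdef]; ring
  have hQ₁ : ∀ y : BondL2K ℂ d (fineP L m) c₀ W, ‖QtorusW L m hL φ U' hα1' hU1' hreg' (c₁ := c₁) y‖ ≤ (MQ + CQf * ε) * ‖y‖ := fun y => by
    have h' : ‖QtorusW L m hL φ U' hα1' hU1' hreg' (c₁ := c₁) y -
        QtorusW L m hL φ (fun _ => 1) (show (0 : ℝ) ≤ 1 / 64 by norm_num) (hU1_one L m) (hreg_one L m) (c₁ := c₁) y‖ ≤ CQf * ε * ‖y‖ := by
      refine (norm_QtorusW_sub_flat_le L m hL U' hα1' hU1' hreg' (show (0 : ℝ) ≤ 1 / 64 by norm_num) (hU1_one L m) (hreg_one L m) hε hU'ε φ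
        hMφ hφ hMφ' hφ' y).trans (le_of_eq ?_)
      rw [hCQfdef]; ring
    calc ‖QtorusW L m hL φ U' hα1' hU1' hreg' (c₁ := c₁) y‖
        = ‖(QtorusW L m hL φ U' hα1' hU1' hreg' (c₁ := c₁) y -
            QtorusW L m hL φ (fun _ => 1) (show (0 : ℝ) ≤ 1 / 64 by norm_num) (hU1_one L m) (hreg_one L m) (c₁ := c₁) y) +
            QtorusW L m hL φ (fun _ => 1) (show (0 : ℝ) ≤ 1 / 64 by norm_num) (hU1_one L m) (hreg_one L m) (c₁ := c₁) y‖ := by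
          rw [sub_add_cancel]
      _ ≤ CQf * ε * ‖y‖ + MQ * ‖y‖ := (norm_add_le _ _).trans (add_le_add h' (hQflat y))
      _ = (MQ + CQf * ε) * ‖y‖ := by ring
  have hMD : (0 : ℝ) ≤ 2 * (1 + KR * ε) * ‖((η : ℂ))⁻¹‖ * Real.sqrt d := by positivity
  have hMQ' : 0 ≤ MQ + CQf * ε := by positivity
  have hδD : (0 : ℝ) ≤ ‖((η : ℂ))⁻¹‖ * (KR * δ₀) * Real.sqrt d := by positivity
  have hδRR : 0 ≤ CR * δ := by positivity
  have hδQ : 0 ≤ CQ * δ₀ := by positivity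
  -- the assembly (the real constant is closed by `assemble_budget`, not by unification)
  have key := @norm_laplaceAK_sub_le ℂ _ (BondL2K ℂ d (fineP L m) c₀ W) (SiteL2K ℂ d (fineP L m) c₀ W) (BondL2K ℂ d m c₁ W)
    _ _ _ _ _ _ _ _ (principalOpK φ η U') (principalOpK φ η U)
    (covDerivL2K ℂ c₀ ((η : ℂ))⁻¹ (adTransportW φ U')) (covDerivL2K ℂ c₀ ((η : ℂ))⁻¹ (adTransportW φ U))
    (RofU L m φ η U') (RofU L m φ η U)
    (covDivL2K ℂ c₀ ((η : ℂ))⁻¹ (adTransportW φ fun b => (U' b)⁻¹)) (covDivL2K ℂ c₀ ((η : ℂ))⁻¹ (adTransportW φ fun b => (U b)⁻¹))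
    (QtorusW L m hL φ U' hα1' hU1' hreg' (c₁ := c₁)) (QtorusW L m hL φ U hα1 hU1 hreg (c₁ := c₁))
    a _ _ _ _ _ _ hMD hMQ' hδD hδRR hδQ hP hD hDs hD₁ hDs₂ hRn₁ hRn₂ hRd hQ hQ₁ x
  refine key.trans (mul_le_mul_of_nonneg_right ?_ (norm_nonneg _))
  have hbud := assemble_budget (p := ‖((η : ℂ))⁻¹‖) (a := a) hdn hsd hKR hCR.le hCQ hCQf hMQ hε hε1 hKε1 hδ hδ₀ hδ₀δ hδ₀ε
  rw [hKdef]
  exact hbud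

/-! ## §2 The chain's ASSEMBLED `Δ_a(U)` between two small-bond backgrounds -/

section Assembled

variable [StarRing 𝔸] [NormedStarGroup 𝔸] [StarModule ℂ 𝔸]

/-- **(3.84) «Δ_a(U′U) = Δ_a(U) − V(A)» WITH `‖V‖ = O(‖U′U − U‖)` FOR THE CHAIN'S ASSEMBLED `Δ_a` AT A GENERAL SMALL-BOND `U`**: there are `C_Δ, ε₆ > 0`
(finite-lattice numbers) such that for every pair `U`, `U′` of backgrounds with their `QtorusW` letters, `U(b), U′(b) ∈ U1`, `‖U(b) − 1‖, ‖U′(b) − 1‖ ≤ ε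
≤ ε₆`, `‖U(b) − U′(b)‖ ≤ δ`, `hRS`, `hRS′`: `‖Δ_a(U)x − Δ_a(U′)x‖ ≤ C_Δ·δ·‖x‖` — §1 plus the curvature part `‖Δ′(U)x − Δ′(U′)x‖ ≤
384d·C_τM_φ²(|η|^d∕c₀)|η|⁻²·(δ ∧ 2ε)·‖x‖` (`B9Ineq369CurvatureTwoBackgrounds`; `U`'s plaquette holonomies within `4ε ≤ 1` of `1`).
[cite: Balaban1985BackgroundPropagators, (3.82)–(3.84) p.407, (3.69) p.404, (3.26) p.395] -/
theorem exists_laplaceAofBackground_sub_laplaceAofBackground_le {η : ℝ} (hη : η ≠ 0) (a : ℝ) {Mφ Mφ' : ℝ} (hMφ : 0 ≤ Mφ) (hMφ' : 0 ≤ Mφ')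
    (hφ : ∀ w, ‖φ w‖ ≤ Mφ * ‖w‖) (hφ' : ∀ X, ‖φ.symm X‖ ≤ Mφ' * ‖X‖) (τ : 𝔸 →ₗ[ℂ] ℂ) {Cτ : ℝ} (hτ : ∀ X, ‖τ X‖ ≤ Cτ * ‖X‖) (hCτ : 0 ≤ Cτ) :
    ∃ CΔ ε₆ : ℝ, 0 < CΔ ∧ 0 < ε₆ ∧ ∀ (U U' : Bond d (fineP L m) → 𝔸ˣ) {α α' : ℝ} (hα1 : α ≤ 1 / 64)
      (hU1 : ∀ (x : B7Prop1Explicit.Site d) (κ : Fin d), perCfg (fineP L m) U x κ ∈ U1 𝔸)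
      (hreg : ∀ (y : TSite d m) (κ : Fin d) (r : Fin d → Fin L), ‖((Wcx L (perCfg (fineP L m) U) (cornerSite L y) κ (boxVec L r) : 𝔸ˣ) : 𝔸) - 1‖ ≤ α)
      (hα1' : α' ≤ 1 / 64)
      (hU1' : ∀ (x : B7Prop1Explicit.Site d) (κ : Fin d), perCfg (fineP L m) U' x κ ∈ U1 𝔸)
      (hreg' : ∀ (y : TSite d m) (κ : Fin d) (r : Fin d → Fin L), ‖((Wcx L (perCfg (fineP L m) U') (cornerSite L y) κ (boxVec L r) : 𝔸ˣ) : 𝔸) - 1‖ ≤ α')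
      {ε δ : ℝ}, 0 ≤ ε → ε ≤ ε₆ → 0 ≤ δ →
      (∀ b, U b ∈ U1 𝔸) → (∀ b, U' b ∈ U1 𝔸) → (∀ b, ‖(U b : 𝔸) - 1‖ ≤ ε) → (∀ b, ‖(U' b : 𝔸) - 1‖ ≤ ε) →
      (∀ b, ‖(U b : 𝔸) - (U' b : 𝔸)‖ ≤ δ) →
      (∀ (b : Bond d (fineP L m)) (v u : W), ⟪adTransportW φ U b v, u⟫_ℂ = ⟪v, adTransportW φ (fun b => (U b)⁻¹) b u⟫_ℂ) →
      (∀ (b : Bond d (fineP L m)) (v u : W), ⟪adTransportW φ U' b v, u⟫_ℂ = ⟪v, adTransportW φ (fun b => (U' b)⁻¹) b u⟫_ℂ) →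
      ∀ x : BondL2K ℂ d (fineP L m) c₀ W,
        ‖laplaceAofBackground L m hL φ U hα1 hU1 hreg τ η (c₀ := c₀) (c₁ := c₁) a x -
          laplaceAofBackground L m hL φ U' hα1' hU1' hreg' τ η (c₀ := c₀) (c₁ := c₁) a x‖ ≤ CΔ * δ * ‖x‖ := by
  have hc₀ : 0 < c₀ := Fact.out
  obtain ⟨K, ε₀, hK, hε₀, HP⟩ := exists_principalGF_sub_principalGF_linear L m hL φ (c₀ := c₀) (c₁ := c₁) hη a hMφ hMφ' hφ hφ'
  obtain ⟨Kc, hKcdef⟩ : ∃ Kc : ℝ, Kc = 384 * d * Cτ * Mφ ^ 2 * (|η| ^ d / c₀) * ‖((η : ℂ))⁻¹‖ ^ 2 := ⟨_, rfl⟩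
  have hKc : 0 ≤ Kc := by rw [hKcdef]; positivity
  refine ⟨K + Kc + 1, min ε₀ (1 / 4), by positivity, by positivity, ?_⟩
  intro U U' α α' hα1 hU1 hreg hα1' hU1' hreg' ε δ hε hε₆ hδ hUb hU'b hUε hU'ε hUU' hRS hRS' x
  have hεε₀ : ε ≤ ε₀ := hε₆.trans (min_le_left _ _)
  have hε4 : 4 * ε ≤ 1 := by have := hε₆.trans (min_le_right _ _); linarith
  have hUb2 : ∀ b : Bond d (fineP L m), ‖(U b : 𝔸)‖ ≤ 1 ∧ ‖(((U b)⁻¹ : 𝔸ˣ) : 𝔸)‖ ≤ 1 := fun b => B7Prop1Explicit.mem_U1.1 (hUb b)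
  have hU'b2 : ∀ b : Bond d (fineP L m), ‖(U' b : 𝔸)‖ ≤ 1 ∧ ‖(((U' b)⁻¹ : 𝔸ˣ) : 𝔸)‖ ≤ 1 := fun b => B7Prop1Explicit.mem_U1.1 (hU'b b)
  -- the effective distance `δ₀ = δ ∧ 2ε` for the curvature part
  obtain ⟨δ₀, hδ₀def⟩ : ∃ δ₀ : ℝ, δ₀ = min δ (2 * ε) := ⟨_, rfl⟩
  have hδ₀ : 0 ≤ δ₀ := by rw [hδ₀def]; exact le_min hδ (by positivity)
  have hδ₀δ : δ₀ ≤ δ := by rw [hδ₀def]; exact min_le_left _ _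
  have hUU'₀ : ∀ b, ‖(U b : 𝔸) - (U' b : 𝔸)‖ ≤ δ₀ := fun b => by
    rw [hδ₀def]
    refine le_min (hUU' b) ?_
    calc ‖(U b : 𝔸) - (U' b : 𝔸)‖ = ‖((U b : 𝔸) - 1) - ((U' b : 𝔸) - 1)‖ := by rw [sub_sub_sub_cancel_right]
      _ ≤ ‖(U b : 𝔸) - 1‖ + ‖(U' b : 𝔸) - 1‖ := norm_sub_le _ _
      _ ≤ 2 * ε := by linarith [hUε b, hU'ε b]
  -- the principal part
  have hP := HP U U' hα1 hU1 hreg hα1' hU1' hreg' hε hεε₀ hδ hUb hU'b hUε hU'ε hUU' hRS hRS' x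
  -- the curvature part
  have hpl : ∀ p : B9SectCLatticeCarrier.Plaq d (fineP L m), ‖(plaqHolU U p : 𝔸) - 1‖ ≤ 4 * ε := norm_plaqHolU_sub_one_le hUb hUε
  have hC : ‖curvOp φ τ η U x - curvOp φ τ η U' x‖ ≤ Kc * δ₀ * ‖x‖ := by
    refine (norm_curvOp_sub_le φ hτ hCτ hφ η hUb2 hU'b2 hδ₀ hUU'₀ hε4 hpl hMφ x).trans (le_of_eq ?_)
    rw [hKcdef]; ring
  -- the decomposition `Δ_a(V) = P(V)-assembly + Δ′(V)`
  have hV_eq : ∀ (V : Bond d (fineP L m) → 𝔸ˣ) {β : ℝ} (hβ : β ≤ 1 / 64)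
      (hV1 : ∀ (x : B7Prop1Explicit.Site d) (κ : Fin d), perCfg (fineP L m) V x κ ∈ U1 𝔸)
      (hregV : ∀ (y : TSite d m) (κ : Fin d) (r : Fin d → Fin L), ‖((Wcx L (perCfg (fineP L m) V) (cornerSite L y) κ (boxVec L r) : 𝔸ˣ) : 𝔸) - 1‖ ≤ β),
      laplaceAofBackground L m hL φ V hβ hV1 hregV τ η (c₀ := c₀) (c₁ := c₁) a x =
        laplaceALatticeK ((η : ℂ))⁻¹ (adTransportW φ V) (adTransportW φ fun b => (V b)⁻¹) (principalOpK φ η V) (RofU L m φ η V)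
          (QtorusW L m hL φ V hβ hV1 hregV (c₁ := c₁)) a x + curvOp φ τ η V x := by
    intro V β hβ hV1 hregV
    show laplaceALatticeK ((η : ℂ))⁻¹ (adTransportW φ V) (adTransportW φ fun b => (V b)⁻¹) (hessOp φ η V τ) (RofU L m φ η V)
        (QtorusW L m hL φ V hβ hV1 hregV (c₁ := c₁)) a x = _
    simp only [laplaceALatticeK, B11Eq103H1Complex.laplaceAK_apply, hessOp_apply]
    abel
  rw [hV_eq U hα1 hU1 hreg, hV_eq U' hα1' hU1' hreg', add_sub_add_comm]
  calc _ ≤ ‖laplaceALatticeK ((η : ℂ))⁻¹ (adTransportW φ U) (adTransportW φ fun b => (U b)⁻¹) (principalOpK φ η U) (RofU L m φ η U)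
            (QtorusW L m hL φ U hα1 hU1 hreg (c₁ := c₁)) a x -
          laplaceALatticeK ((η : ℂ))⁻¹ (adTransportW φ U') (adTransportW φ fun b => (U' b)⁻¹) (principalOpK φ η U') (RofU L m φ η U')
            (QtorusW L m hL φ U' hα1' hU1' hreg' (c₁ := c₁)) a x‖ +
        ‖curvOp φ τ η U x - curvOp φ τ η U' x‖ := norm_add_le _ _
    _ ≤ K * δ * ‖x‖ + Kc * δ₀ * ‖x‖ := add_le_add hP hC
    _ ≤ K * δ * ‖x‖ + Kc * δ * ‖x‖ := by
        have := mul_le_mul_of_nonneg_left hδ₀δ hKc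
        nlinarith [norm_nonneg x]
    _ ≤ (K + Kc + 1) * δ * ‖x‖ := by nlinarith [norm_nonneg x, mul_nonneg hδ (norm_nonneg x)]

end Assembled

end Literature.MathematicalPhysics.QuantumFieldTheory.Balaban1983to89.B9Eq384LaplaceALipschitzTwoBackgrounds

end
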